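import Literature.Geometry.Riemannian.MetricFlowFLimitPairAux3
import Literature.Geometry.Riemannian.MetricFlowFLimitGradient
import Literature.Geometry.Riemannian.MetricFlowGradientPropertyZeroOfPos
import HarnessLib

/-!
# The limit of a fast `𝔽`-Cauchy chain within a correspondence, IV: the gradient property of the
# limit (Bamler 2023, §5.4, Lemma 5.20, Claim 5.22, Property (6))

R. Bamler, *Compactness theory of the space of super Ricci flows*, Invent. Math. 233 (2023), §5.4,
proof of Lemma 5.20 (arXiv v1 Lemma 121), Claim 5.22 (arXiv v1 Claim 123): *"To see Property (6)
let `s, t ∈ I ∖ E^∞`, `s < t`, `T > 0` and consider a `T^{-1}`-Lipschitz function `f : X^∞_s → ℝ`.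
Then the function `f̂ : Z_s → ℝ`, `f̂(x) := inf_{z ∈ X^∞_s} (f(z) + T^{-1} d(x, z))` is also
`T^{-1}`-Lipschitz. It follows that the functions `hⁱ : 𝒳ⁱ_t → ℝ`,
`x ↦ Φ^{-1}(∫ (Φ ∘ f̂ ∘ φⁱ_s) dνⁱ_{x;s})` are `(t − s + T)^{-1}`-Lipschitz. By Claim 5.21 for any
`xⁱ ∈ 𝒳ⁱ_t` with `φⁱ_t(xⁱ) → x^∞ ∈ X^∞_t` we have `hⁱ(xⁱ) → Φ^{-1}(∫ Φ(f) dν_{x^∞;s})`. This shows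
that `X^∞_t → ℝ`, `x ↦ Φ^{-1}(∫ Φ(f) dν^∞_{x^∞;s})` is `(t − s + T)^{-1}`-Lipschitz, and therefore
Property (6) if `T > 0`. By Lemma 3.? (`T` positive suffices) this implies the case `T = 0`."*

Continuing `MetricFlowFLimitPairAux3.lean` (limit slices `S.X t ht`, kernels `S.kernel ht x hs` of
the fast chain `S : ChainSetup I₀`), this file assembles Property (6) of Def. 3.2 for the limit, in
the exact shape of the field `MetricFlow.gradient_property`:

* `ChainSetup.const_or_lipschitz_approx` — the input from the approximants: for `s < t` in `I'^{,n}`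
  and EVERY `K`-Lipschitz `g` on `𝒳ⁿ_s`, `x ↦ ∫ Φ ∘ g dνⁿ_{x;s}` is constant or `Φ ∘ g'` with `g'`
  `(t − s)^{-1/2}`-Lipschitz (Def. 3.2 (6) of `𝒳ⁿ` with `T' := K'^{-2}`, `K' := max K 1`, and
  `(t − s + T')^{-1/2} ≤ (t − s)^{-1/2}`);
* `ChainSetup.const_or_lipschitz_of_lipschitz` — the passage to the limit for data `Φ ∘ f`, `f`
  `K`-Lipschitz on `X^∞_s` (extend `f` to `Z_s`, `const_or_exists_lipschitz_of_kernel_limit`,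
  restrict `f'` to `X^∞_t`);
* `ChainSetup.gradient_property_limit` — Property (6) for the limit: the case `T > 0` directly, the
  case `T = 0` through `MetricFlow.const_or_exists_lipschitz_integral_eq_Phi` (Bamler's Lemma 3.?:
  it suffices to verify (6) for `T > 0`).

## References

* R. H. Bamler, *Compactness theory of the space of super Ricci flows*, Invent. Math. 233 (2023),
  1121–1277 (arXiv:2008.09298), §5.4, Lemma 5.20, Claims 5.21–5.22 (arXiv v1 Lemma 121,
  Claims 122–123); §3.1, Def. 3.2 (6) and the Lemma (`T > 0` suffices). [Bamler2023]
-/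

noncomputable section

open Set MeasureTheory Filter TopologicalSpace Function
open scoped Topology ENNReal NNReal

namespace Literature.Geometry.Riemannian

universe u

namespace MetricFlowPair

open MetricFlow

namespace ChainSetup

variable {I₀ : Set ℝ} (S : ChainSetup.{u} I₀)

/-- **The gradient property of the approximants, for every Lipschitz constant**: for `s < t` in
`I'^{,n}` and a `K`-Lipschitz `g : 𝒳ⁿ_s → ℝ`, `x ↦ ∫ Φ ∘ g dνⁿ_{x;s}` on `𝒳ⁿ_t` is constant or of
the form `Φ ∘ g'` with `g'` `(t − s)^{-1/2}`-Lipschitz (Def. 3.2 (6) of `𝒳ⁿ` with `T' := K'^{-2}`,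
`K' := max K 1`, so that `g` is `T'^{-1/2} = K'`-Lipschitz, and `(t − s + T')^{-1/2} ≤ (t −
s)^{-1/2}`).
[cite: Bamler2023, §3.1, Def. 3.2 (6); §5.4, Lemma 5.20, Claim 5.22 (arXiv v1 Claim 123)] -/
theorem const_or_lipschitz_approx (n : ℕ) {s t : (S.P n).I'} (hst : (s : ℝ) < t) (K : ℝ≥0)
    (g : (S.P n).flow.Slice s → ℝ) (hg : LipschitzWith K g) :
    (∃ c, ∀ x : (S.P n).flow.Slice t, ∫ y, Phi (g y) ∂((S.P n).flow.condKernel x s) = c) ∨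
      ∃ g' : (S.P n).flow.Slice t → ℝ,
        LipschitzWith (Real.toNNReal (1 / Real.sqrt ((t : ℝ) - s))) g' ∧
          ∀ x, ∫ y, Phi (g y) ∂((S.P n).flow.condKernel x s) = Phi (g' x) := by
  set K' : ℝ≥0 := max K 1 with hK'
  have hK'1 : (1 : ℝ) ≤ K' := by
    have h : (1 : ℝ≥0) ≤ K' := le_max_right K 1
    exact_mod_cast h
  set T' : ℝ := ((K' : ℝ)⁻¹) ^ 2 with hT'_def
  have hT' : 0 < T' := by positivity
  have hsqrt : Real.sqrt T' = (K' : ℝ)⁻¹ := Real.sqrt_sq (inv_nonneg.2 K'.coe_nonneg)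
  have hKT : Real.toNNReal (1 / Real.sqrt T') = K' := by
    rw [hsqrt, one_div, inv_inv, Real.toNNReal_coe]
  have hgK' : LipschitzWith (Real.toNNReal (1 / Real.sqrt T')) g := by
    rw [hKT]
    exact hg.weaken (le_max_left K 1)
  have h := (S.P n).flow.gradient_property hst T' hT'.le (fun y ↦ Phi (g y))
    (Phi_mono.measurable.comp hg.continuous.measurable) (fun y ↦ Phi_mem_Icc (g y))
    fun _ ↦ ⟨g, hgK', rfl⟩
  rcases h with ⟨c, hc⟩ | ⟨g', hg', hg'eq⟩
  · exact Or.inl ⟨c, hc⟩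
  · refine Or.inr ⟨g', hg'.weaken (Real.toNNReal_le_toNNReal ?_), hg'eq⟩
    have hts : 0 < (t : ℝ) - s := sub_pos.2 hst
    exact one_div_le_one_div_of_le (Real.sqrt_pos.2 hts) (Real.sqrt_le_sqrt (by linarith))

/-- **Claim 5.22, Property (6) for data `Φ ∘ f`**: if for a pair of constants `(K, L)` every
approximant `𝒳ⁿ` maps `Φ ∘ (K-Lipschitz)` data at time `s` to constants or `Φ ∘ (L-Lipschitz)`
functions at time `t`, then so does the limit: for `f : X^∞_s → ℝ` `K`-Lipschitz,
`x ↦ ∫ Φ ∘ f dν^∞_{x;s}` on `X^∞_t` is constant or `Φ ∘ f'` with `f'` `L`-Lipschitz. As printed: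
extend `f` to `f̂ : Z_s → ℝ` (`K`-Lipschitz), pass to the limit along approximating sequences
(`const_or_exists_lipschitz_of_kernel_limit`), and restrict to `X^∞_t`.
[cite: Bamler2023, §5.4, Lemma 5.20, Claim 5.22 (arXiv v1 Claim 123)] -/
theorem const_or_lipschitz_of_lipschitz {s t : ℝ} (hs : s ∈ S.I') (ht : t ∈ S.I') (hst : s < t)
    {K L : ℝ≥0}
    (hadm : ∀ n (hsn : s ∈ (S.P n).I') (htn : t ∈ (S.P n).I')
      (g : (S.P n).flow.Slice ⟨s, hsn⟩ → ℝ), LipschitzWith K g →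
      (∃ c, ∀ x : (S.P n).flow.Slice ⟨t, htn⟩,
          ∫ y, Phi (g y) ∂((S.P n).flow.condKernel x ⟨s, hsn⟩) = c) ∨
        ∃ g' : (S.P n).flow.Slice ⟨t, htn⟩ → ℝ, LipschitzWith L g' ∧
          ∀ x, ∫ y, Phi (g y) ∂((S.P n).flow.condKernel x ⟨s, hsn⟩) = Phi (g' x))
    (f : S.X s hs → ℝ) (hf : LipschitzWith K f) :
    (∃ c, ∀ x : S.X t ht, ∫ y, Phi (f y) ∂(S.kernel ht x hs) = c) ∨
      ∃ f' : S.X t ht → ℝ, LipschitzWith L f' ∧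
        ∀ x, ∫ y, Phi (f y) ∂(S.kernel ht x hs) = Phi (f' x) := by
  obtain ⟨i, hsi, hti⟩ := S.exists_mem_G₂ hs ht
  obtain ⟨fZ, hfZ, hfZf⟩ := exists_lipschitz_extension f hf
  haveI := fun k (y : (S.P (i + k)).flow.Slice
      ⟨t, (S.ℭ.dom_subset (i + k) (S.memDom hti k)).1⟩) ↦
    (S.P (i + k)).flow.isProbabilityMeasure_condKernel y
      (s := ⟨s, (S.ℭ.dom_subset (i + k) (S.memDom hsi k)).1⟩) hst.le
  have key := const_or_exists_lipschitz_of_kernel_limit (Zs := S.ℭ.Z ⟨s, hs.1⟩)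
    (Zt := S.ℭ.Z ⟨t, ht.1⟩)
    (fun k ↦ S.ℭ.φ (i + k) s (S.memDom hsi k)) (fun k ↦ S.ℭ.φ (i + k) t (S.memDom hti k))
    (fun k ↦ S.ℭ.isometry (i + k) s (S.memDom hsi k))
    (fun k ↦ S.ℭ.isometry (i + k) t (S.memDom hti k))
    (fun k x ↦ (S.P (i + k)).flow.condKernel x ⟨s, (S.ℭ.dom_subset (i + k) (S.memDom hsi k)).1⟩)
    (K := K) (L := L) (fun k g hg ↦ hadm (i + k) _ _ g hg)
    (S.m t ht).support (fun w hw ↦ S.exists_seq_tendsto ht hti hw)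
    (fun w ↦ S.νZ hs ht w) (fun w hw ↦ S.isProbabilityMeasure_νZ hs ht hst.le hw)
    (fun w hw x hx ↦ S.tendsto_kpush_νZ hs ht hst.le hw hsi hti x hx) fZ hfZ
  -- transport of the integrals to `Z_s`
  have htr : ∀ x : S.X t ht,
      ∫ y, Phi (f y) ∂(S.kernel ht x hs) = ∫ z, Phi (fZ z) ∂(S.νZ hs ht x.1) := fun x ↦
    S.integral_kernel_eq_of_extension hs ht hst.le x (u := fun y ↦ Phi (f y))
      (g := fun z ↦ Phi (fZ z)) fun y ↦ by rw [hfZf y]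
  rcases key with ⟨c, hc⟩ | ⟨f', hf', hf'eq⟩
  · exact Or.inl ⟨c, fun x ↦ (htr x).trans (hc x.1 x.2)⟩
  · exact Or.inr ⟨fun x ↦ f' x.1, LipschitzWith.of_dist_le_mul fun x y ↦ hf'.dist_le_mul x.1 y.1,
      fun x ↦ (htr x).trans (hf'eq x.1 x.2)⟩

/-- **Claim 5.22, Property (6) of Def. 3.2 for the limit flow**, in the shape of
`MetricFlow.gradient_property`: for `s < t` in `I'^{,∞}`, `T ≥ 0` and a measurable
`u : X^∞_s → [0, 1]` (of the form `Φ ∘ f` with `f` `T^{-1/2}`-Lipschitz if `T > 0`), the function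
`x ↦ ∫ u dν^∞_{x;s}` on `X^∞_t` is constant or `Φ ∘ f'` with `f'` `(t − s + T)^{-1/2}`-Lipschitz.
The case `T > 0` is `const_or_lipschitz_of_lipschitz` with the gradient property of the
approximants; the case `T = 0` follows from the case of all `T > 0`
(`const_or_exists_lipschitz_integral_eq_Phi`).
[cite: Bamler2023, §5.4, Lemma 5.20, Claim 5.22 (arXiv v1 Claim 123)] -/
theorem gradient_property_limit {s t : ℝ} (hs : s ∈ S.I') (ht : t ∈ S.I') (hst : s < t) (T : ℝ)
    (hT : 0 ≤ T) (u : S.X s hs → ℝ) (hu : Measurable u) (h01 : ∀ y, u y ∈ Icc (0 : ℝ) 1)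
    (hLip : 0 < T → ∃ f : S.X s hs → ℝ,
      LipschitzWith (Real.toNNReal (1 / Real.sqrt T)) f ∧ u = MetricFlow.Phi ∘ f) :
    (∃ c : ℝ, ∀ x : S.X t ht, ∫ y, u y ∂(S.kernel ht x hs) = c) ∨
      ∃ f' : S.X t ht → ℝ, LipschitzWith (Real.toNNReal (1 / Real.sqrt (t - s + T))) f' ∧
        ∀ x : S.X t ht, ∫ y, u y ∂(S.kernel ht x hs) = MetricFlow.Phi (f' x) := by
  rcases hT.eq_or_lt with hT0 | hTpos
  · -- `T = 0`: from the case of all `T' > 0` (Bamler's Lemma: `T` positive suffices)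
    subst hT0
    rw [add_zero]
    haveI := fun x : S.X t ht ↦ S.isProbabilityMeasure_kernel hs ht hst.le x
    exact const_or_exists_lipschitz_integral_eq_Phi (fun x : S.X t ht ↦ S.kernel ht x hs)
      (Real.toNNReal (1 / Real.sqrt (t - s)))
      (fun K f hf ↦ S.const_or_lipschitz_of_lipschitz hs ht hst
        (fun n hsn htn g hg ↦
          S.const_or_lipschitz_approx n (s := ⟨s, hsn⟩) (t := ⟨t, htn⟩) hst K g hg)
        f hf) u hu h01
  · -- `T > 0`: `u = Φ ∘ f` with `f` `T^{-1/2}`-Lipschitz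
    obtain ⟨f, hf, rfl⟩ := hLip hTpos
    exact S.const_or_lipschitz_of_lipschitz hs ht hst (K := Real.toNNReal (1 / Real.sqrt T))
      (L := Real.toNNReal (1 / Real.sqrt (t - s + T)))
      (fun n hsn htn g hg ↦ (S.P n).flow.gradient_property (s := ⟨s, hsn⟩) (t := ⟨t, htn⟩) hst T hT
        (fun y ↦ Phi (g y)) (Phi_mono.measurable.comp hg.continuous.measurable)
        (fun y ↦ Phi_mem_Icc (g y)) fun _ ↦ ⟨g, hg, rfl⟩) f hf

end ChainSetup

end MetricFlowPair

end Literature.Geometry.Riemannian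

end
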